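import Mathlib

/-!
# OverbindingBudget — Taylor-model cells for the far-window certificate, part 1/16 «Taylor»

MODULE PLAN (lens-4 g68, at hand-2's landing-shape request of 2026-09-02T14:19Z, critic row 1199 (II)) of the VERIFIED g67 leaf
`OverbindingBudgetAffineTaylorCell.lean` (sha256 `dabedef39e0c5fd2…`, 4214 l, critic row 1196): this module = leaf l.47–223
(§1 exact Taylor identities (section Taylor)), body VERBATIM except as listed in `MAP.md` — here: leaf module docstring l.3-45 kept verbatim; `namespace` line l.47 is the part header.
Same namespace `…Theorems.OverbindingBudgetAffineTaylorCell` in all 16 parts (declaration names unchanged); the parts import each other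
linearly.  No `sorry`, no `native_decide`, standard axioms; no instances/notation; scoped `set_option maxHeartbeats` with explicit bounds only.
-/

/-!
# OverbindingBudget — TAYLOR-MODEL CELLS for the far-window certificate (slot Z, leaf Z2; lens-4 g67)

The leaf of the Taylor-cell architecture for the far-window table `hcert` of `farCoreExcess_of_hcpEnclosures` (tree
`…HcpReference`).  The zeroth-order "box-by-box" format cannot close the table (NODE memo `NODE-g67-TaylorCells.md` §0:
`≳ 10¹⁶` interval boxes, because the two window sums `T₃↑, T₆↓` move together at first order while their certified
combination is stationary at the reference shape); a Taylor model of every near term in the five free GRAM COORDINATES of the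
cell, with the remainder summed termwise, keeps the cancellation exactly.  Measured cell law and budget: memo §0 ‡‡ (order 5 with
gradient-aligned cells ≈ 1.6·10⁴ cells per window class, ≈ 3.7 core-minutes of kernel time each).

Contents.
* §1 `inv_pow_taylor_*`: exact Taylor identities with remainder for `(1+u)⁻³`, `(1+u)⁻⁶`, orders `J = 3, 4, 5`, and the bounds
  `|R_J(u)| ≤ |u|^J · N_J(η) / (1 − η)^m` for `|u| ≤ η < 1`.
* §2 `term_model4_*`, `family_model4_*`: one term `s^{-m}` at `s = c + ℓ`, and an abstract finite family.
* §3 the `ℚ` kernel: `Mono`/`monos` (126 slots of degree `≤ 4`), `Cell` — centre `G_c`, five DIRECTION MATRICES `M_j` (K6,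
  `Dir5`; default `Dir5.std` = axis-aligned; a gradient-aligned cell is the parallelotope `G_c + Σ_j t_j M_j`, `|t_j| ≤ h_j`),
  half-widths, order `J`, denominator `D` — `termQ`/`remQ`, directed rounding `rdn`/`rup` to `1/D`, the one-pass accumulator
  `Cell.acc` with closed forms `acc_coef`/`acc_rem`/`acc_ok_iff`.
* §4 ★ `Cell.acc_sound_m3_J4` / `acc_sound_m6_J4`: on the whole box the kernel polynomial is within `rem + 126·|vs|/D` of the true sum.
* §5 the slot product truncated at degree 4 (`slotProd`, ★ `slotProd_sound`; kernel form `slotProdF`).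
* §6 quadratic forms and the `LDLᵀ` residual rule (`PSDCert`, ★ `QF.eval_ge_of_cert`).
* §7 slot-list algebra (`addConst`, `linComb`, `cornerSum`, `qfOfList`, ★ `evalCoef_map_ge`).
* §8 the ROW: `CertRow.check` (one kernel-decidable Bool per cell) and ★★ `CertRow.check_sound`
  (`check = true` ⇒ `B·(six-sum + far₃)² ≤ A·(twelve-sum + far₆)` at every real point of the box); `check_of_lit` /
  `check_false_of_lit` assemble the check from bounded kernel jobs on materialised slot lists; chunked accumulation.
* §9 the INTEGER kernel `CellZ` (`K = NᵀgN`, `L_j = NᵀM_jN` with INTEGER direction matrices `DirZ5`, one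
  Euclidean division per slot) with ★ `rcZ_cast`/`coefZ_cast`: the integer table divided by `D` IS the `ℚ` table (×5.5 faster,
  whole 954-vector family in one kernel job); `W_of_chunksZ`/`V_of_chunksZ`.
* `section Probe`: the hcp families (`hcpVecsSmall`, 134 vectors; `hcpVecs`, 954 vectors, `|v| ≤ 5.5`) and small kernel runs.  The
  certified cells live in the probe files `TCcertKernel80z.lean` (`h = 1/80`, order 4, certified), `TCcertKernel64z.lean` (`h = 1/64`,
  order 4, rejected), `TCcertKernel64z5.lean` (`h = 1/64`, order 5, certified), `TCcertKernel250z5F.lean` (true slack, order 5,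
  certified) and `TCcertKernelA{1,2,4,8}z5.lean` (K6: GRADIENT-ALIGNED order-5 parallelotopes at 1.5 / 3 / 6 / 12 % strain along
  the probe ray, all certified, 6–11× the volume of the uniform cells there), each = this file's text up to `section Probe` (+§10)
  + one probe section.
* §10 the ORDER-5 twin: `Cell.acc_sound_m3_J5`/`_m6_J5`, `CertRow.check5` and ★★ `CertRow.check5_sound` (all 126 slots active,
  sextic remainder) — the format the measured budget makes load-bearing.
* §11 the ÷12 QUOTIENT KIT: Gram-point sums `gramSum`, the bridge `Cell.trueSum_eq_gramSum`, congruence `SymR.cong` and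
  `gramSum_cong`, the 12-element site group of `hcpVecs` with `decide +kernel`-certified permutations (`siteP0…11_perm`),
  ★ `gramSum_site_invariant`, scaling `gramSum_smul`, and `Cell.cert_at_gramPoint` (a cell certificate holds at the 12 congruence
  images of its parallelotope).

No `sorry`, no `native_decide`, standard axioms; instances/notation: none.
(Leaf docstring above kept verbatim; the `section Probe` examples it mentions live in HOME probe files, not in the landed modules.)
-/

namespace Summit.AtomisticToContinuum.Crystallization.Theorems.OverbindingBudgetAffineTaylorCell

/-! ## §1 Exact Taylor identities with remainder for `(1+u)⁻ᵐ`, `m = 3, 6` -/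

section Taylor
variable (u : ℝ)

/-- `inv_pow_taylor_m3_J3` (docstring added by the landing lane; see the module docstring). [formal bookkeeping] -/
theorem inv_pow_taylor_m3_J3 (hu : 0 < 1 + u) :
    ((1 + u) ^ 3)⁻¹ = 1 - 3 * u + 6 * u ^ 2 - u ^ 3 * (10 + 15 * u + 6 * u ^ 2) / (1 + u) ^ 3 := by
  have h : (1 + u) ≠ 0 := hu.ne'
  field_simp
  ring

/-- `inv_pow_taylor_m3_J4` (docstring added by the landing lane; see the module docstring). [formal bookkeeping] -/
theorem inv_pow_taylor_m3_J4 (hu : 0 < 1 + u) :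
    ((1 + u) ^ 3)⁻¹ = 1 - 3 * u + 6 * u ^ 2 - 10 * u ^ 3 + u ^ 4 * (15 + 24 * u + 10 * u ^ 2) / (1 + u) ^ 3 := by
  have h : (1 + u) ≠ 0 := hu.ne'
  field_simp
  ring

/-- `inv_pow_taylor_m3_J5` (docstring added by the landing lane; see the module docstring). [formal bookkeeping] -/
theorem inv_pow_taylor_m3_J5 (hu : 0 < 1 + u) :
    ((1 + u) ^ 3)⁻¹ = 1 - 3 * u + 6 * u ^ 2 - 10 * u ^ 3 + 15 * u ^ 4
      - u ^ 5 * (21 + 35 * u + 15 * u ^ 2) / (1 + u) ^ 3 := by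
  have h : (1 + u) ≠ 0 := hu.ne'
  field_simp
  ring

/-- `inv_pow_taylor_m6_J3` (docstring added by the landing lane; see the module docstring). [formal bookkeeping] -/
theorem inv_pow_taylor_m6_J3 (hu : 0 < 1 + u) :
    ((1 + u) ^ 6)⁻¹ = 1 - 6 * u + 21 * u ^ 2
      - u ^ 3 * (56 + 210 * u + 336 * u ^ 2 + 280 * u ^ 3 + 120 * u ^ 4 + 21 * u ^ 5) / (1 + u) ^ 6 := by
  have h : (1 + u) ≠ 0 := hu.ne'
  field_simp
  ring

/-- `inv_pow_taylor_m6_J4` (docstring added by the landing lane; see the module docstring). [formal bookkeeping] -/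
theorem inv_pow_taylor_m6_J4 (hu : 0 < 1 + u) :
    ((1 + u) ^ 6)⁻¹ = 1 - 6 * u + 21 * u ^ 2 - 56 * u ^ 3
      + u ^ 4 * (126 + 504 * u + 840 * u ^ 2 + 720 * u ^ 3 + 315 * u ^ 4 + 56 * u ^ 5) / (1 + u) ^ 6 := by
  have h : (1 + u) ≠ 0 := hu.ne'
  field_simp
  ring

/-- `inv_pow_taylor_m6_J5` (docstring added by the landing lane; see the module docstring). [formal bookkeeping] -/
theorem inv_pow_taylor_m6_J5 (hu : 0 < 1 + u) :
    ((1 + u) ^ 6)⁻¹ = 1 - 6 * u + 21 * u ^ 2 - 56 * u ^ 3 + 126 * u ^ 4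
      - u ^ 5 * (252 + 1050 * u + 1800 * u ^ 2 + 1575 * u ^ 3 + 700 * u ^ 4 + 126 * u ^ 5) / (1 + u) ^ 6 := by
  have h : (1 + u) ≠ 0 := hu.ne'
  field_simp
  ring

/-- The generic remainder estimate: `|u^J · N / (1+u)^m| ≤ |u|^J · B / (1-η)^m` when `|u| ≤ η < 1` and `|N| ≤ B`. -/
theorem remainder_abs_le {u η N B : ℝ} {J m : ℕ} (hη : η < 1) (hu : |u| ≤ η) (hN : |N| ≤ B) :
    |u ^ J * N / (1 + u) ^ m| ≤ |u| ^ J * B / (1 - η) ^ m := by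
  have hη0 : 0 < 1 - η := by linarith
  have h1u : 1 - η ≤ |1 + u| := by
    have : 1 - |u| ≤ |1 + u| := by
      have := abs_add_le (1 + u) (-u)
      simp only [add_neg_cancel_right, abs_one, abs_neg] at this
      linarith
    linarith
  have hB : 0 ≤ B := (abs_nonneg N).trans hN
  rw [abs_div, abs_mul, abs_pow, abs_pow]
  have hden : 0 < |1 + u| ^ m := pow_pos (hη0.trans_le h1u) m
  rw [div_le_div_iff₀ hden (pow_pos hη0 m)]
  calc |u| ^ J * |N| * (1 - η) ^ m ≤ |u| ^ J * B * (1 - η) ^ m := by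
        gcongr
    _ ≤ |u| ^ J * B * |1 + u| ^ m := by
        gcongr

/-- `|N(u)| ≤ N(η)` for a polynomial with nonnegative coefficients (the six numerators above), degree ≤ 5. -/
theorem poly_abs_le_of_abs_le {u η a0 a1 a2 a3 a4 a5 : ℝ} (hu : |u| ≤ η) (h0 : 0 ≤ a0) (h1 : 0 ≤ a1) (h2 : 0 ≤ a2)
    (h3 : 0 ≤ a3) (h4 : 0 ≤ a4) (h5 : 0 ≤ a5) :
    |a0 + a1 * u + a2 * u ^ 2 + a3 * u ^ 3 + a4 * u ^ 4 + a5 * u ^ 5|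
      ≤ a0 + a1 * η + a2 * η ^ 2 + a3 * η ^ 3 + a4 * η ^ 4 + a5 * η ^ 5 := by
  have hη : 0 ≤ η := (abs_nonneg u).trans hu
  have hp : ∀ k : ℕ, |u| ^ k ≤ η ^ k := fun k => pow_le_pow_left₀ (abs_nonneg u) hu k
  calc |a0 + a1 * u + a2 * u ^ 2 + a3 * u ^ 3 + a4 * u ^ 4 + a5 * u ^ 5|
      ≤ |a0| + |a1 * u| + |a2 * u ^ 2| + |a3 * u ^ 3| + |a4 * u ^ 4| + |a5 * u ^ 5| := by
        have := abs_add_le (a0 + a1 * u + a2 * u ^ 2 + a3 * u ^ 3 + a4 * u ^ 4) (a5 * u ^ 5)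
        have := abs_add_le (a0 + a1 * u + a2 * u ^ 2 + a3 * u ^ 3) (a4 * u ^ 4)
        have := abs_add_le (a0 + a1 * u + a2 * u ^ 2) (a3 * u ^ 3)
        have := abs_add_le (a0 + a1 * u) (a2 * u ^ 2)
        have := abs_add_le a0 (a1 * u)
        linarith
    _ = a0 + a1 * |u| + a2 * |u| ^ 2 + a3 * |u| ^ 3 + a4 * |u| ^ 4 + a5 * |u| ^ 5 := by
        simp only [abs_mul, abs_pow, abs_of_nonneg h0, abs_of_nonneg h1, abs_of_nonneg h2, abs_of_nonneg h3,
          abs_of_nonneg h4, abs_of_nonneg h5]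
    _ ≤ a0 + a1 * η + a2 * η ^ 2 + a3 * η ^ 3 + a4 * η ^ 4 + a5 * η ^ 5 := by
        have e1 := hp 1; have e2 := hp 2; have e3 := hp 3; have e4 := hp 4; have e5 := hp 5
        simp only [pow_one] at e1
        nlinarith [mul_le_mul_of_nonneg_left e1 h1, mul_le_mul_of_nonneg_left e2 h2,
          mul_le_mul_of_nonneg_left e3 h3, mul_le_mul_of_nonneg_left e4 h4, mul_le_mul_of_nonneg_left e5 h5]

/-- ★ Order-4 model of `(1+u)⁻³` (`n = 6` terms): `|(1+u)⁻³ − (1 − 3u + 6u² − 10u³)| ≤ |u|⁴(15 + 24η + 10η²)/(1−η)³`. -/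
theorem inv_pow_three_model4_abs {u η : ℝ} (hη : η < 1) (hu : |u| ≤ η) :
    |((1 + u) ^ 3)⁻¹ - (1 - 3 * u + 6 * u ^ 2 - 10 * u ^ 3)| ≤ |u| ^ 4 * (15 + 24 * η + 10 * η ^ 2) / (1 - η) ^ 3 := by
  have hu1 : 0 < 1 + u := by
    have : -u ≤ |u| := neg_le_abs u
    linarith
  rw [inv_pow_taylor_m3_J4 u hu1]
  have hN : |(15 : ℝ) + 24 * u + 10 * u ^ 2 + 0 * u ^ 3 + 0 * u ^ 4 + 0 * u ^ 5| ≤ 15 + 24 * η + 10 * η ^ 2 + 0 * η ^ 3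
      + 0 * η ^ 4 + 0 * η ^ 5 :=
    poly_abs_le_of_abs_le hu (by norm_num) (by norm_num) (by norm_num) le_rfl le_rfl le_rfl
  have h := remainder_abs_le (J := 4) (m := 3) hη hu hN
  simp only [zero_mul, add_zero] at h
  convert h using 2
  ring

/-- ★ Order-4 model of `(1+u)⁻⁶` (`n = 12` terms). -/
theorem inv_pow_six_model4_abs {u η : ℝ} (hη : η < 1) (hu : |u| ≤ η) :
    |((1 + u) ^ 6)⁻¹ - (1 - 6 * u + 21 * u ^ 2 - 56 * u ^ 3)|
      ≤ |u| ^ 4 * (126 + 504 * η + 840 * η ^ 2 + 720 * η ^ 3 + 315 * η ^ 4 + 56 * η ^ 5) / (1 - η) ^ 6 := by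
  have hu1 : 0 < 1 + u := by
    have : -u ≤ |u| := neg_le_abs u
    linarith
  rw [inv_pow_taylor_m6_J4 u hu1]
  have hN := poly_abs_le_of_abs_le (a0 := 126) (a1 := 504) (a2 := 840) (a3 := 720) (a4 := 315) (a5 := 56) hu
    (by norm_num) (by norm_num) (by norm_num) (by norm_num) (by norm_num) (by norm_num)
  have h := remainder_abs_le (J := 4) (m := 6) hη hu hN
  convert h using 2
  ring

/-- Order-3 and order-5 variants (quadratic model / quartic model), `m = 3`. -/
theorem inv_pow_three_model3_abs {u η : ℝ} (hη : η < 1) (hu : |u| ≤ η) :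
    |((1 + u) ^ 3)⁻¹ - (1 - 3 * u + 6 * u ^ 2)| ≤ |u| ^ 3 * (10 + 15 * η + 6 * η ^ 2) / (1 - η) ^ 3 := by
  have hu1 : 0 < 1 + u := by
    have : -u ≤ |u| := neg_le_abs u
    linarith
  rw [show (((1 + u) ^ 3)⁻¹ - (1 - 3 * u + 6 * u ^ 2)) = -(u ^ 3 * (10 + 15 * u + 6 * u ^ 2) / (1 + u) ^ 3) by
    rw [inv_pow_taylor_m3_J3 u hu1]; ring, abs_neg]
  have hN : |(10 : ℝ) + 15 * u + 6 * u ^ 2 + 0 * u ^ 3 + 0 * u ^ 4 + 0 * u ^ 5| ≤ 10 + 15 * η + 6 * η ^ 2 + 0 * η ^ 3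
      + 0 * η ^ 4 + 0 * η ^ 5 :=
    poly_abs_le_of_abs_le hu (by norm_num) (by norm_num) (by norm_num) le_rfl le_rfl le_rfl
  have h := remainder_abs_le (J := 3) (m := 3) hη hu hN
  simp only [zero_mul, add_zero] at h
  exact h

/-- `inv_pow_three_model5_abs` (docstring added by the landing lane; see the module docstring). [formal bookkeeping] -/
theorem inv_pow_three_model5_abs {u η : ℝ} (hη : η < 1) (hu : |u| ≤ η) :
    |((1 + u) ^ 3)⁻¹ - (1 - 3 * u + 6 * u ^ 2 - 10 * u ^ 3 + 15 * u ^ 4)|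
      ≤ |u| ^ 5 * (21 + 35 * η + 15 * η ^ 2) / (1 - η) ^ 3 := by
  have hu1 : 0 < 1 + u := by
    have : -u ≤ |u| := neg_le_abs u
    linarith
  rw [show (((1 + u) ^ 3)⁻¹ - (1 - 3 * u + 6 * u ^ 2 - 10 * u ^ 3 + 15 * u ^ 4)) = -(u ^ 5 * (21 + 35 * u + 15 * u ^ 2) / (1 + u) ^ 3) by
    rw [inv_pow_taylor_m3_J5 u hu1]; ring, abs_neg]
  have hN : |(21 : ℝ) + 35 * u + 15 * u ^ 2 + 0 * u ^ 3 + 0 * u ^ 4 + 0 * u ^ 5| ≤ 21 + 35 * η + 15 * η ^ 2 + 0 * η ^ 3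
      + 0 * η ^ 4 + 0 * η ^ 5 :=
    poly_abs_le_of_abs_le hu (by norm_num) (by norm_num) (by norm_num) le_rfl le_rfl le_rfl
  have h := remainder_abs_le (J := 5) (m := 3) hη hu hN
  simp only [zero_mul, add_zero] at h
  exact h

/-- `inv_pow_six_model3_abs` (docstring added by the landing lane; see the module docstring). [formal bookkeeping] -/
theorem inv_pow_six_model3_abs {u η : ℝ} (hη : η < 1) (hu : |u| ≤ η) :
    |((1 + u) ^ 6)⁻¹ - (1 - 6 * u + 21 * u ^ 2)|
      ≤ |u| ^ 3 * (56 + 210 * η + 336 * η ^ 2 + 280 * η ^ 3 + 120 * η ^ 4 + 21 * η ^ 5) / (1 - η) ^ 6 := by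
  have hu1 : 0 < 1 + u := by
    have : -u ≤ |u| := neg_le_abs u
    linarith
  rw [show (((1 + u) ^ 6)⁻¹ - (1 - 6 * u + 21 * u ^ 2)) = -(u ^ 3 * (56 + 210 * u + 336 * u ^ 2 + 280 * u ^ 3 + 120 * u ^ 4 + 21 * u ^ 5) / (1 + u) ^ 6) by
    rw [inv_pow_taylor_m6_J3 u hu1]; ring, abs_neg]
  have hN := poly_abs_le_of_abs_le (a0 := 56) (a1 := 210) (a2 := 336) (a3 := 280) (a4 := 120) (a5 := 21) hu
    (by norm_num) (by norm_num) (by norm_num) (by norm_num) (by norm_num) (by norm_num)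
  have h := remainder_abs_le (J := 3) (m := 6) hη hu hN
  exact h

/-- `inv_pow_six_model5_abs` (docstring added by the landing lane; see the module docstring). [formal bookkeeping] -/
theorem inv_pow_six_model5_abs {u η : ℝ} (hη : η < 1) (hu : |u| ≤ η) :
    |((1 + u) ^ 6)⁻¹ - (1 - 6 * u + 21 * u ^ 2 - 56 * u ^ 3 + 126 * u ^ 4)|
      ≤ |u| ^ 5 * (252 + 1050 * η + 1800 * η ^ 2 + 1575 * η ^ 3 + 700 * η ^ 4 + 126 * η ^ 5) / (1 - η) ^ 6 := by
  have hu1 : 0 < 1 + u := by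
    have : -u ≤ |u| := neg_le_abs u
    linarith
  rw [show (((1 + u) ^ 6)⁻¹ - (1 - 6 * u + 21 * u ^ 2 - 56 * u ^ 3 + 126 * u ^ 4)) = -(u ^ 5 * (252 + 1050 * u + 1800 * u ^ 2 + 1575 * u ^ 3 + 700 * u ^ 4 + 126 * u ^ 5) / (1 + u) ^ 6) by
    rw [inv_pow_taylor_m6_J5 u hu1]; ring, abs_neg]
  have hN := poly_abs_le_of_abs_le (a0 := 252) (a1 := 1050) (a2 := 1800) (a3 := 1575) (a4 := 700) (a5 := 126) hu
    (by norm_num) (by norm_num) (by norm_num) (by norm_num) (by norm_num) (by norm_num)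
  have h := remainder_abs_le (J := 5) (m := 6) hη hu hN
  exact h

end Taylor

end Summit.AtomisticToContinuum.Crystallization.Theorems.OverbindingBudgetAffineTaylorCell
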